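import Mathlib
import Summits.ResolutionOfSingularities.ResolutionOfSingularities.Theorems.WildQuotientsWildQuotientResolutionZ9PeeledRootChartAKL
import Summits.ResolutionOfSingularities.ResolutionOfSingularities.Theorems.WildQuotientsWildQuotientResolutionFixedPointsGraded
import Summits.ResolutionOfSingularities.ResolutionOfSingularities.Theorems.WildQuotientsWildQuotientResolutionToricExitRootChartInvariants

/-!
# The ℤ9 specimen, piece `P₀`: the K–L ring `k[x]^ξ` of the `x_a`-root chart, GRADED by the `μ₇`-weight

(crux stmt-ResolutionOfSingularities-15640 `WildQuotients.WildQuotientResolution`, S1 = stmt-…-17941; ℤ9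
SPECIMEN brick Z6 (V-BR) of res-L1-w45c-idea-2's `cardP_g12/Z9-SPECIMEN.md` §2/§4: «S := k[s, x₁′, x₂′, w]^{σ̃}
… graded by the μ₇-weight (ℤ/7 ≅ D(μ₇) diagonalizable); 𝒮 0 = Γ(P₀)^{σ̃}»; res-L1-w45c-stub-1 TAKING
2026-08-27T18:28:03Z «P₀ PACKAGE». [OURS · L1 W4.5c] — assembly of landed decls (res-L1-w45c-stub-3's root
lift `ξ` / `rootLiftA_fixedPoints_isRegularRing`, B1″ `TameTransfer.exists_gradedAlgebra_fixedPoints_zpowers`);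
NOT a statement of any manuscript. Prover res-L1-w45c-stub-1. Def-free.)

Letters: `a b c d : Fin n` distinct; the root lift `ξ` of res-L1-w45c-stub-3 (`ξ x_a = x_a`,
`ξ x_b = x_b + x_a³`, `ξ x_c = x_c + x_a³ x_b`, `ξ x_d = x_d + x_a³ (x_c³ − x_a¹² x_c)`, passengers fixed);
the `μ₇`-WEIGHT `w₇ : Fin n → ZMod 7`, `w₇(a,b,c) = (1,3,6)`, `0` elsewhere.

* `rootLiftA_isWeightedHomogeneous` — `ξ` preserves `w₇`-homogeneity and weight (it is weighted-graded);
* `finite_zpowers_rootLiftA` — `⟨ξ⟩` is finite (`ξ³ = 1`, `ξ ≠ 1`, char `3`);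
* `exists_gradedAlgebra_rootLiftA_fixedPoints` — **the V-BR datum of `P₀`, algebra side**: a
  `GradedAlgebra 𝒮` on `S = k[x]^⟨ξ⟩` indexed by `ZMod 7` with `s ∈ 𝒮 i ↔ IsWeightedHomogeneous w₇ s i`;
  `S` is of finite type and (char `3`) REGULAR.
-/

-- single-problem summit: the doubled namespace component `ResolutionOfSingularities` is forced
set_option linter.dupNamespace false

noncomputable section

open MvPolynomial

namespace Summit.ResolutionOfSingularities.ResolutionOfSingularities.Theorems.WildQuotientResolution.Z9Peeled

variable (k : Type) [Field k] (n : ℕ) (a b c d : Fin n)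
  (hab : a ≠ b) (hac : a ≠ c) (had : a ≠ d) (hbc : b ≠ c) (hbd : b ≠ d) (hcd : c ≠ d)
  (ξ : MvPolynomial (Fin n) k ≃ₐ[k] MvPolynomial (Fin n) k)
  (hξa : ξ (X a) = X a) (hξb : ξ (X b) = X b + X a ^ 3) (hξc : ξ (X c) = X c + X a ^ 3 * X b)
  (hξd : ξ (X d) = X d + X a ^ 3 * (X c ^ 3 - X a ^ 12 * X c))
  (hξ : ∀ i, i ≠ b → i ≠ c → i ≠ d → ξ (X i) = X i)

/-- The `μ₇`-weight `w₇(a,b,c) = (1,3,6)`, `0` on the other letters (local shorthand). -/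
local notation3 "w₇" => (fun i : Fin n => if i = a then (1 : ZMod 7) else if i = b then 3
    else if i = c then 6 else 0)

/-- `w₇ a = 1`. [folklore] -/
theorem weightSeven_a : w₇ a = 1 := by simp

include hab in
/-- `w₇ b = 3`. [folklore] -/
theorem weightSeven_b : w₇ b = 3 := by simp [hab.symm]

include hac hbc in
/-- `w₇ c = 6`. [folklore] -/
theorem weightSeven_c : w₇ c = 6 := by simp [hac.symm, hbc.symm]

variable {a b c} in
/-- `w₇ i = 0` off `{a, b, c}`. [folklore] -/
theorem weightSeven_of_ne {i : Fin n} (hia : i ≠ a) (hib : i ≠ b) (hic : i ≠ c) : w₇ i = 0 := by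
  simp [hia, hib, hic]

include hab hac had hbc hbd hcd hξa hξb hξc hξd hξ in
/-- **`ξ` is `w₇`-graded on the letters**: `ξ (x_j)` is `w₇`-homogeneous of weight `w₇ j`. [folklore] -/
theorem rootLiftA_X_isWeightedHomogeneous (j : Fin n) :
    IsWeightedHomogeneous w₇ (ξ (X j)) (w₇ j) := by
  have hXa : IsWeightedHomogeneous w₇ (X a : MvPolynomial (Fin n) k) 1 := by
    simpa using isWeightedHomogeneous_X k w₇ a
  have hXb : IsWeightedHomogeneous w₇ (X b : MvPolynomial (Fin n) k) 3 := by
    simpa [hab.symm] using isWeightedHomogeneous_X k w₇ b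
  have hXc : IsWeightedHomogeneous w₇ (X c : MvPolynomial (Fin n) k) 6 := by
    simpa [hac.symm, hbc.symm] using isWeightedHomogeneous_X k w₇ c
  have hXd : IsWeightedHomogeneous w₇ (X d : MvPolynomial (Fin n) k) 0 := by
    simpa [had.symm, hbd.symm, hcd.symm] using isWeightedHomogeneous_X k w₇ d
  have h3 : IsWeightedHomogeneous w₇ (X a ^ 3 : MvPolynomial (Fin n) k) 3 := by
    simpa using hXa.pow 3
  by_cases hja : j = a
  · rw [hja, hξa]; simpa using hXa
  by_cases hjb : j = b
  · rw [hjb, hξb]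
    have : w₇ b = 3 := by simp [hab.symm]
    rw [this]
    exact hXb.add h3
  by_cases hjc : j = c
  · rw [hjc, hξc]
    have : w₇ c = 6 := by simp [hac.symm, hbc.symm]
    rw [this]
    have h36 : IsWeightedHomogeneous w₇ (X a ^ 3 * X b : MvPolynomial (Fin n) k) (3 + 3) := h3.mul hXb
    have e : (3 : ZMod 7) + 3 = 6 := by decide
    rw [e] at h36
    exact hXc.add h36
  by_cases hjd : j = d
  · rw [hjd, hξd]
    have : w₇ d = 0 := by simp [had.symm, hbd.symm, hcd.symm]
    rw [this]
    have h1 : IsWeightedHomogeneous w₇ (X c ^ 3 : MvPolynomial (Fin n) k) (3 • 6) := hXc.pow 3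
    have h2 : IsWeightedHomogeneous w₇ (X a ^ 12 * X c : MvPolynomial (Fin n) k) (12 • 1 + 6) :=
      (hXa.pow 12).mul hXc
    have e1 : (3 • 6 : ZMod 7) = 4 := by decide
    have e2 : (12 • 1 + 6 : ZMod 7) = 4 := by decide
    rw [e1] at h1
    rw [e2] at h2
    have h12 : IsWeightedHomogeneous w₇ (X c ^ 3 - X a ^ 12 * X c : MvPolynomial (Fin n) k) 4 := by
      have hm := (weightedHomogeneousSubmodule k w₇ (4 : ZMod 7)).sub_mem
        ((mem_weightedHomogeneousSubmodule k w₇ 4 _).mpr h1)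
        ((mem_weightedHomogeneousSubmodule k w₇ 4 _).mpr h2)
      exact (mem_weightedHomogeneousSubmodule k w₇ 4 _).mp hm
    have h : IsWeightedHomogeneous w₇ (X a ^ 3 * (X c ^ 3 - X a ^ 12 * X c) : MvPolynomial (Fin n) k)
        (3 + 4) := h3.mul h12
    have e3 : (3 : ZMod 7) + 4 = 0 := by decide
    rw [e3] at h
    exact hXd.add h
  · rw [hξ j hjb hjc hjd]
    exact isWeightedHomogeneous_X k w₇ j

include hab hac had hbc hbd hcd hξa hξb hξc hξd hξ in
/-- **`ξ` preserves `w₇`-homogeneity and weight.** [folklore] -/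
theorem rootLiftA_isWeightedHomogeneous (i : ZMod 7) (u : MvPolynomial (Fin n) k)
    (hu : IsWeightedHomogeneous w₇ u i) : IsWeightedHomogeneous w₇ (ξ u) i := by
  have hξeq : (ξ : MvPolynomial (Fin n) k →ₐ[k] MvPolynomial (Fin n) k) =
      aeval (fun j => ξ (X j)) := MvPolynomial.algHom_ext fun j => by simp
  have h := ToricExit.isWeightedHomogeneous_aeval w₇ w₇ (fun j => ξ (X j))
    (rootLiftA_X_isWeightedHomogeneous k n a b c d hab hac had hbc hbd hcd ξ hξa hξb hξc hξd hξ) u i hu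
  have hu' : ξ u = aeval (fun j => ξ (X j)) u := by
    change (ξ : MvPolynomial (Fin n) k →ₐ[k] MvPolynomial (Fin n) k) u = _
    rw [hξeq]
  rw [hu']
  exact h

include hξa hξb hξc hξd hξ in
/-- `⟨ξ⟩` is finite (`ξ³ = 1`, `ξ ≠ 1` in characteristic `3`). [folklore] -/
theorem finite_zpowers_rootLiftA [CharP k 3] : Finite ↥(Subgroup.zpowers ξ) := by
  haveI : Fact (Nat.Prime 3) := ⟨Nat.prime_three⟩
  refine Nat.finite_of_card_ne_zero ?_
  rw [Nat.card_zpowers, orderOf_eq_prime (rootLiftA_pow_three_eq_one k n a b c d ξ hξa hξb hξc hξd hξ)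
    (rootLiftA_ne_one k n a b ξ hξb)]
  norm_num

include hab hac had hbc hbd hcd hξa hξb hξc hξd hξ in
/-- **The V-BR datum of `P₀`, algebra side.** `S = k[x]^⟨ξ⟩` carries a `GradedAlgebra 𝒮` indexed by
`ZMod 7` (`≅ D(μ₇)`) whose `i`-th piece is the invariants of `μ₇`-weight `i`
(`s ∈ 𝒮 i ↔ IsWeightedHomogeneous w₇ s i`); `S` is of finite type over `k` and, in characteristic `3`,
REGULAR (Király–Lütkebohmert, res-L1-w45c-stub-3). [OURS · L1 W4.5c] [folklore; assembly of landed decls] -/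
theorem exists_gradedAlgebra_rootLiftA_fixedPoints [CharP k 3] :
    ∃ (𝒮 : ZMod 7 → Submodule k
        ↥(FixedPoints.subalgebra k (MvPolynomial (Fin n) k) ↥(Subgroup.zpowers ξ)))
      (_ : GradedAlgebra 𝒮),
      Algebra.FiniteType k ↥(FixedPoints.subalgebra k (MvPolynomial (Fin n) k) ↥(Subgroup.zpowers ξ)) ∧
      IsRegularRing ↥(FixedPoints.subalgebra k (MvPolynomial (Fin n) k) ↥(Subgroup.zpowers ξ)) ∧
      ∀ (i : ZMod 7) (s : ↥(FixedPoints.subalgebra k (MvPolynomial (Fin n) k) ↥(Subgroup.zpowers ξ))),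
        s ∈ 𝒮 i ↔ IsWeightedHomogeneous w₇ (s : MvPolynomial (Fin n) k) i := by
  classical
  letI : GradedAlgebra (weightedHomogeneousSubmodule k w₇) := MvPolynomial.weightedGradedAlgebra k w₇
  obtain ⟨𝒮, h𝒮, hmem⟩ := TameTransfer.exists_gradedAlgebra_fixedPoints_zpowers
    (weightedHomogeneousSubmodule k w₇) ξ (fun i u hu => by
      rw [mem_weightedHomogeneousSubmodule] at hu ⊢
      exact rootLiftA_isWeightedHomogeneous k n a b c d hab hac had hbc hbd hcd ξ hξa hξb hξc hξd hξ
        i u hu)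
  haveI := finite_zpowers_rootLiftA k n a b c d ξ hξa hξb hξc hξd hξ
  refine ⟨𝒮, h𝒮, inferInstance,
    rootLiftA_fixedPoints_isRegularRing k n a b c d ξ hξa hξb hξc hξd hξ, fun i s => ?_⟩
  rw [hmem, mem_weightedHomogeneousSubmodule]

end Summit.ResolutionOfSingularities.ResolutionOfSingularities.Theorems.WildQuotientResolution.Z9Peeled

end
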